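import Summits.BirchSwinnertonDyer.BirchSwinnertonDyer.Theorems.ByReductionTypeAtTwoRankOneSigmaHeightTateRate
import HarnessLib

/-!
# Route `ByReductionTypeAtTwo`, crux `RankOneAtTwoBigImageOddLocal` (item stmt-BirchSwinnertonDyer-23715), line AN62, σ₀-LEMMA BLOCK
# (cell `bsd-f1-sign2`, planner seat `-an` g50; `--supports 23715`, helper):
# **TATE'S LIMIT FORMULA FOR A σ-FORM 2-ADIC HEIGHT: `⟨Q,Q⟩_D = lim_{k→∞} 4⁻ᵏ·log₂ num x(2ᵏQ)` in `ℚ₂`**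

HONEST FRAMING (D-0036/D-0054): THEOREMS ONLY (no definition, no named fact, no `sorry`, no instance).  With the binders of
`…SigmaHeightTateFormula` (`V/ℚ` `ℤ`-integral, `a₁ = 0`; `D : PAdicHeightData V 2` given on the local-conditions locus by the σ-formula of a
normalised solution `Sq` of the σ²-ODE) and `Q = (x, y)` with `‖x‖₂ ≥ 4` and non-singular reduction at every prime: the Tate tower
`2ᵏQ = (x_k, y_k)` exists (`exists_seq_two_pow_nsmul`) and `4⁻ᵏ·log₂ num x_k → ⟨Q,Q⟩_D` in `ℚ₂` (`tendsto_inv_pow_mul_padicLog_num`), at the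
geometric rate `2·4⁻ᵏ·‖x‖₂⁻²` of `…SigmaHeightTateRate`.  In particular the value `⟨Q,Q⟩_D` on such `Q` does not depend on `Sq` or `D`
(`pairing_eq_of_sigma_formula`: any two σ-form data agree there) — Tate's limit with the Iwasawa logarithm of the NUMERATOR in place of the
naive height, at `p = 2`.  Nothing here is a statement about `BSDp`; item 23715 stays OPEN; BSD is proved for no curve.
References: [cite: SilvermanAEC2009, VIII.9] [cite: MazurSteinTate2006, §1].
-/

set_option autoImplicit false

noncomputable section

open scoped Classical Topology

open Filter WeierstrassCurve PowerSeries Literature Literature.NumberTheory.EllipticCurves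

namespace Summit.BirchSwinnertonDyer.BirchSwinnertonDyer.Theorems

namespace NaiveSigmaLogAtTwo

/-- The Tate tower `2ᵏQ = (x_k, y_k)` of a point of level `≥ 1` (`a₁ = 0`) as sequences. [cite: SilvermanAEC2009, VIII.9] -/
theorem exists_seq_two_pow_nsmul (V : WeierstrassCurve ℚ) [V.IsIntegral ℤ] (ha1 : V.a₁ = 0) {x y : ℚ}
    (h : V.toAffine.Nonsingular x y) (hx : (4 : ℝ) ≤ ‖(x : ℚ_[2])‖) :
    ∃ (xs ys : ℕ → ℚ) (hs : ∀ k, V.toAffine.Nonsingular (xs k) (ys k)),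
      ∀ k, (2 ^ k : ℕ) • (.some x y h : V.toAffine.Point) = .some (xs k) (ys k) (hs k) := by
  choose xs ys hs hk using fun k => exists_two_pow_nsmul_eq_some V ha1 h hx k
  exact ⟨xs, ys, hs, hk⟩

/-- **TATE'S LIMIT FORMULA (kernel, `p = 2`, σ-form height)**: `4⁻ᵏ·log₂ num x(2ᵏQ) → ⟨Q,Q⟩_D` in `ℚ₂` for `Q = (x, y)` with `‖x‖₂ ≥ 4`,
`a₁ = 0`, non-singular reduction everywhere, along ANY presentation `2ᵏQ = (x_k, y_k)` of the Tate tower.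
[cite: SilvermanAEC2009, VIII.9] [cite: MazurSteinTate2006, §1] -/
theorem tendsto_inv_pow_mul_padicLog_num (V : WeierstrassCurve ℚ) [V.IsIntegral ℤ] (ha1 : V.a₁ = 0) (Sq : ℚ_[2]⟦X⟧)
    (h0 : constantCoeff Sq = 0) (h1 : coeff 1 Sq = 0) (h2 : coeff 2 Sq = 1) (h3 : coeff 3 Sq = 0)
    (hODE : (V.baseChange ℚ_[2]).SatisfiesSigmaSqODE Sq 0) (D : PAdicHeightData V 2)
    (hD : ∀ {x y : ℚ} (h : V.toAffine.Nonsingular x y), V.SatisfiesLocalConditions 2 (.some x y h) →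
      D.pairing (.some x y h) (.some x y h) = padicLog 2 ((x.den : ℚ) : ℚ_[2]) - padicLog 2 (padicEval Sq (-(x : ℚ_[2]) / y)))
    {x y : ℚ} (h : V.toAffine.Nonsingular x y) (hx : (4 : ℝ) ≤ ‖(x : ℚ_[2])‖)
    (hns : ∀ ℓ : ℕ, ℓ.Prime → V.HasNonsingularReductionAt ℓ x y)
    (xs ys : ℕ → ℚ) (hs : ∀ k, V.toAffine.Nonsingular (xs k) (ys k))
    (hk : ∀ k, (2 ^ k : ℕ) • (.some x y h : V.toAffine.Point) = .some (xs k) (ys k) (hs k)) :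
    Tendsto (fun k : ℕ => ((4 : ℚ_[2]) ^ k)⁻¹ * padicLog 2 ((xs k).num : ℚ_[2])) atTop
      (𝓝 (D.pairing (.some x y h) (.some x y h))) := by
  rw [tendsto_iff_norm_sub_tendsto_zero]
  have hrate : Tendsto (fun k : ℕ => 2 * ((4 : ℝ) ^ k)⁻¹ * ‖(x : ℚ_[2])‖⁻¹ ^ 2) atTop (𝓝 0) := by
    have h4 : Tendsto (fun k : ℕ => ((4 : ℝ) ^ k)⁻¹) atTop (𝓝 0) := by
      simpa [← inv_pow] using tendsto_pow_atTop_nhds_zero_of_lt_one (by norm_num : (0 : ℝ) ≤ 4⁻¹) (by norm_num : (4 : ℝ)⁻¹ < 1)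
    have := (h4.const_mul 2).mul_const (‖(x : ℚ_[2])‖⁻¹ ^ 2)
    simpa using this
  refine squeeze_zero_norm' ?_ hrate
  filter_upwards [eventually_ge_atTop 1] with k hk1
  rw [Real.norm_eq_abs, abs_norm, norm_sub_rev]
  exact norm_pairing_sub_inv_mul_padicLog_num_le_rate V ha1 Sq h0 h1 h2 h3 hODE D hD h hx hns k hk1 (hs k) (hk k)

/-- **σ-form data agree on the Tate-tower locus**: two height data `D, D′` given by σ-formulas (for possibly DIFFERENT normalised solutions
`Sq, Sq′`) take the same value `⟨Q,Q⟩` on every `Q = (x, y)` with `‖x‖₂ ≥ 4`, `a₁ = 0`, non-singular reduction everywhere — both are the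
limit of `4⁻ᵏ·log₂ num x(2ᵏQ)`. [cite: MazurSteinTate2006, §1] -/
theorem pairing_eq_of_sigma_formula (V : WeierstrassCurve ℚ) [V.IsIntegral ℤ] (ha1 : V.a₁ = 0) (Sq Sq' : ℚ_[2]⟦X⟧)
    (h0 : constantCoeff Sq = 0) (h1 : coeff 1 Sq = 0) (h2 : coeff 2 Sq = 1) (h3 : coeff 3 Sq = 0)
    (hODE : (V.baseChange ℚ_[2]).SatisfiesSigmaSqODE Sq 0)
    (h0' : constantCoeff Sq' = 0) (h1' : coeff 1 Sq' = 0) (h2' : coeff 2 Sq' = 1) (h3' : coeff 3 Sq' = 0)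
    (hODE' : (V.baseChange ℚ_[2]).SatisfiesSigmaSqODE Sq' 0) (D D' : PAdicHeightData V 2)
    (hD : ∀ {x y : ℚ} (h : V.toAffine.Nonsingular x y), V.SatisfiesLocalConditions 2 (.some x y h) →
      D.pairing (.some x y h) (.some x y h) = padicLog 2 ((x.den : ℚ) : ℚ_[2]) - padicLog 2 (padicEval Sq (-(x : ℚ_[2]) / y)))
    (hD' : ∀ {x y : ℚ} (h : V.toAffine.Nonsingular x y), V.SatisfiesLocalConditions 2 (.some x y h) →
      D'.pairing (.some x y h) (.some x y h) = padicLog 2 ((x.den : ℚ) : ℚ_[2]) - padicLog 2 (padicEval Sq' (-(x : ℚ_[2]) / y)))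
    {x y : ℚ} (h : V.toAffine.Nonsingular x y) (hx : (4 : ℝ) ≤ ‖(x : ℚ_[2])‖)
    (hns : ∀ ℓ : ℕ, ℓ.Prime → V.HasNonsingularReductionAt ℓ x y) :
    D.pairing (.some x y h) (.some x y h) = D'.pairing (.some x y h) (.some x y h) := by
  obtain ⟨xs, ys, hs, hk⟩ := exists_seq_two_pow_nsmul V ha1 h hx
  exact tendsto_nhds_unique (tendsto_inv_pow_mul_padicLog_num V ha1 Sq h0 h1 h2 h3 hODE D hD h hx hns xs ys hs hk)
    (tendsto_inv_pow_mul_padicLog_num V ha1 Sq' h0' h1' h2' h3' hODE' D' hD' h hx hns xs ys hs hk)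

end NaiveSigmaLogAtTwo

end Summit.BirchSwinnertonDyer.BirchSwinnertonDyer.Theorems
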